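import Mathlib
import Summits.Ventures.HodgeRepro.Statements
import Summits.Ventures.HodgeRepro.MuTableSeesaw

/-!
# The slot table under the seesaw isometry and the seesaw swap (sealed statement (b), blind cell `pub-hodge-repro`, seat p2)

Consequences of the signature invariance of `MuTableSeesaw.lean` for the sealed slot tables `δ_S = slotDelta`,
`δ₂ = slotDelta₂`, `δ₃ = slotDelta₃` and the relabelling bit `conjSwapAt`:

* `slotDelta_eq_zero_iff`: `δ_S(w) = 0` iff `w` is a definite place of `W₀ ⊕ W₁`; `slotDelta_of_not_same_sign`:
  `δ_S(w) = ±3` at a split place;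
* `slotDelta_ne_zero_of_conjSwapAt`: the relabelling bit is set only at SPLIT places (at a definite place the second
  plane is definite of the same sign, so `a₀` and `a₂` cannot have opposite signs); hence `slotDelta₂_ne_zero_iff`:
  `δ₂` is supported exactly on the relabelled places;
* the SWAP `S.swap` (`W₂ ⊕ W₃ ≅ W₀ ⊕ W₁` via `g⁻¹`, a `SeesawDatum` again) and `slotDelta_swap`:
  `δ_{S.swap} = if conjSwapAt then −δ_S else δ_S`, i.e. `δ_{S.swap} = δ₃ − δ₂` (`slotDelta_swap_eq`), so that
  `2 δ₂ = δ_S − δ_{S.swap}` and `2 δ₃ = δ_S + δ_{S.swap}` (`two_mul_slotDelta₂`): the sealed partition `δ_S = δ₂ + δ₃`,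
  `δ₂ δ₃ = 0` is the decomposition of the slot table into its odd and even parts under the seesaw swap — literally:
  `swap_swap : S.swap.swap = S`, `slotDelta₂_swap : δ₂(S.swap) = −δ₂(S)`, `slotDelta₃_swap : δ₃(S.swap) = δ₃(S)`.
-/

set_option autoImplicit false

noncomputable section

namespace Summit.Ventures.HodgeRepro

namespace MuTable

open NumberField

variable {L : Type} [Field L] [NumberField L] [NumberField.IsCMField L]

/-! ### Consequences for the slot table -/

/-- `δ_S(w) = 0` iff `w` is a definite place of `W₀ ⊕ W₁` (`a₀, a₁` of the same sign at `w`). -/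
theorem slotDelta_eq_zero_iff (δ : L) (S : SeesawDatum L) (w : InfinitePlace L) :
    slotDelta δ S w = 0 ↔ (0 < S.r w 0 ↔ 0 < S.r w 1) := by
  unfold slotDelta dW
  simp only [Matrix.cons_val_zero, Matrix.cons_val_one, SeesawDatum.r_def]
  split_ifs with h h1 hδ hδ <;> simp [h]

/-- At a split place `δ_S(w) = ±3`. -/
theorem slotDelta_of_not_same_sign (δ : L) (S : SeesawDatum L) (w : InfinitePlace L)
    (h : ¬ (0 < S.r w 0 ↔ 0 < S.r w 1)) : slotDelta δ S w = 3 ∨ slotDelta δ S w = -3 := by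
  unfold slotDelta dW
  simp only [Matrix.cons_val_zero, Matrix.cons_val_one, SeesawDatum.r_def] at h ⊢
  rw [if_neg h]
  split_ifs <;> norm_num

/-- **The relabelling bit is set only at split places**: `conjSwapAt S w → δ_S(w) ≠ 0`.  (At a definite place of
`W₀ ⊕ W₁` the plane `W₂ ⊕ W₃` is definite of the same sign by `pos_pos` / `neg_neg`, so `a₀` and `a₂` cannot have
opposite signs.) -/
theorem slotDelta_ne_zero_of_conjSwapAt (δ : L) (S : SeesawDatum L) (w : InfinitePlace L)
    (h : conjSwapAt S w) : slotDelta δ S w ≠ 0 := by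
  rw [Ne, slotDelta_eq_zero_iff]
  intro hiff
  unfold conjSwapAt dW dW' at h
  simp only [Matrix.cons_val_zero] at h
  apply h
  by_cases h0 : 0 < S.r w 0
  · obtain ⟨h2, _⟩ := S.pos_pos w h0 (hiff.1 h0)
    exact ⟨fun _ => h2, fun _ => h0⟩
  · have h1 : ¬ 0 < S.r w 1 := fun h1 => h0 (hiff.2 h1)
    have h0' : S.r w 0 < 0 := lt_of_le_of_ne (not_lt.1 h0) (S.r_ne_zero w 0)
    have h1' : S.r w 1 < 0 := lt_of_le_of_ne (not_lt.1 h1) (S.r_ne_zero w 1)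
    obtain ⟨h2, _⟩ := S.neg_neg w h0' h1'
    exact ⟨fun h => absurd h h0, fun h => absurd h (not_lt.2 h2.le)⟩

/-- `δ₂(w) ≠ 0 ↔ conjSwapAt S w`: the cross-plane table `δ₂` is supported exactly on the relabelled places. -/
theorem slotDelta₂_ne_zero_iff (δ : L) (S : SeesawDatum L) (w : InfinitePlace L) :
    slotDelta₂ δ S w ≠ 0 ↔ conjSwapAt S w := by
  unfold slotDelta₂
  split_ifs with h
  · exact ⟨fun _ => h, fun _ => slotDelta_ne_zero_of_conjSwapAt δ S w h⟩
  · exact ⟨fun h' => absurd rfl h', fun h' => absurd h' h⟩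

/-- `δ₂(w) = 0 ↔ ¬ conjSwapAt S w`. -/
theorem slotDelta₂_eq_zero_iff (δ : L) (S : SeesawDatum L) (w : InfinitePlace L) :
    slotDelta₂ δ S w = 0 ↔ ¬ conjSwapAt S w := by
  rw [← slotDelta₂_ne_zero_iff δ S w, not_not]

/-- The partition `δ₂ + δ₃ = δ_S`, `δ₂ · δ₃ = 0` (also proved in `MuTableProof.lean`; repeated here so this file only
imports `Statements`). -/
theorem slotDelta₂_add_slotDelta₃_aux (δ : L) (S : SeesawDatum L) (w : InfinitePlace L) :
    slotDelta₂ δ S w + slotDelta₃ δ S w = slotDelta δ S w ∧ slotDelta₂ δ S w * slotDelta₃ δ S w = 0 := by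
  unfold slotDelta₂ slotDelta₃
  split_ifs <;> simp

/-! ### The seesaw swap `W₂ ⊕ W₃ ≅ W₀ ⊕ W₁` -/

namespace SeesawDatum

/-- The swapped seesaw datum `(a₂, a₃, a₀, a₁)`: the isometry `W₂ ⊕ W₃ ≅ W₀ ⊕ W₁` is the congruence by `g⁻¹`. -/
def swap (S : SeesawDatum L) : SeesawDatum L where
  a := ![S.a 2, S.a 3, S.a 0, S.a 1]
  a_real := by
    intro i
    fin_cases i <;> simp [S.a_real]
  a_ne := by
    intro i
    fin_cases i <;> simp [S.a_ne]
  iso := by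
    obtain ⟨g, hg⟩ := S.iso
    refine ⟨g⁻¹, ?_⟩
    simp only [Matrix.cons_val_zero, Matrix.cons_val_one, Matrix.cons_val_two, Matrix.cons_val_three]
    have hMN : (g : Matrix (Fin 2) (Fin 2) L) * ((g⁻¹ : GL (Fin 2) L) : Matrix (Fin 2) (Fin 2) L) = 1 :=
      Units.mul_inv g
    calc ((g⁻¹ : GL (Fin 2) L) : Matrix (Fin 2) (Fin 2) L).transpose.map (IsCMField.complexConj L) *
          Matrix.diagonal ![S.a 2, S.a 3] * ((g⁻¹ : GL (Fin 2) L) : Matrix (Fin 2) (Fin 2) L)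
        = ((g⁻¹ : GL (Fin 2) L) : Matrix (Fin 2) (Fin 2) L).transpose.map (IsCMField.complexConj L) *
          ((g : Matrix (Fin 2) (Fin 2) L).transpose.map (IsCMField.complexConj L) *
            Matrix.diagonal ![S.a 0, S.a 1] * (g : Matrix (Fin 2) (Fin 2) L)) *
          ((g⁻¹ : GL (Fin 2) L) : Matrix (Fin 2) (Fin 2) L) := by rw [hg]
      _ = (((g⁻¹ : GL (Fin 2) L) : Matrix (Fin 2) (Fin 2) L).transpose.map (IsCMField.complexConj L) *
            (g : Matrix (Fin 2) (Fin 2) L).transpose.map (IsCMField.complexConj L)) *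
          Matrix.diagonal ![S.a 0, S.a 1] *
          ((g : Matrix (Fin 2) (Fin 2) L) * ((g⁻¹ : GL (Fin 2) L) : Matrix (Fin 2) (Fin 2) L)) := by
        simp only [Matrix.mul_assoc]
      _ = ((g : Matrix (Fin 2) (Fin 2) L) * ((g⁻¹ : GL (Fin 2) L) : Matrix (Fin 2) (Fin 2) L)).transpose.map
            (IsCMField.complexConj L) * Matrix.diagonal ![S.a 0, S.a 1] *
          ((g : Matrix (Fin 2) (Fin 2) L) * ((g⁻¹ : GL (Fin 2) L) : Matrix (Fin 2) (Fin 2) L)) := by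
        rw [Matrix.transpose_mul, Matrix.map_mul]
      _ = Matrix.diagonal ![S.a 0, S.a 1] := by
        rw [hMN, Matrix.transpose_one, Matrix.map_one _ (map_zero _) (map_one _), Matrix.one_mul,
          Matrix.mul_one]

/-- The diagonal entries of the swapped datum: the two hermitian planes exchanged. -/
@[simp] theorem swap_a (S : SeesawDatum L) : S.swap.a = ![S.a 2, S.a 3, S.a 0, S.a 1] := rfl

/-- Slot `0` of the swapped datum reads slot `2`. -/
theorem swap_r_zero (S : SeesawDatum L) (w : InfinitePlace L) : S.swap.r w 0 = S.r w 2 := rfl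
/-- Slot `1` of the swapped datum reads slot `3`. -/
theorem swap_r_one (S : SeesawDatum L) (w : InfinitePlace L) : S.swap.r w 1 = S.r w 3 := rfl
/-- Slot `2` of the swapped datum reads slot `0`. -/
theorem swap_r_two (S : SeesawDatum L) (w : InfinitePlace L) : S.swap.r w 2 = S.r w 0 := rfl
/-- Slot `3` of the swapped datum reads slot `1`. -/
theorem swap_r_three (S : SeesawDatum L) (w : InfinitePlace L) : S.swap.r w 3 = S.r w 1 := rfl

end SeesawDatum

/-- The slot table through the sign data: `δ_S(w) = if (0 < r₀ ↔ 0 < r₁) then 0 else (±1)(±3)`. -/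
theorem slotDelta_eq (δ : L) (S : SeesawDatum L) (w : InfinitePlace L) :
    slotDelta δ S w = if (0 < S.r w 0 ↔ 0 < S.r w 1) then 0
      else (if 0 < S.r w 1 then 1 else -1) * (if 0 < (w.embedding δ).im then 3 else -3) := rfl

/-- The relabelling bit through the sign data. -/
theorem conjSwapAt_iff (S : SeesawDatum L) (w : InfinitePlace L) :
    conjSwapAt S w ↔ ¬ (0 < S.r w 0 ↔ 0 < S.r w 2) := Iff.rfl

open scoped Classical in
/-- **The swap reading of the partition**: the slot table of the swapped datum is `δ_S` with the sign flipped exactly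
at the relabelled places — `δ_{S.swap} = δ₃ − δ₂`; so `δ₂` is the part of `δ_S` that changes sign under the seesaw
swap and `δ₃` the part that does not. -/
theorem slotDelta_swap (δ : L) (S : SeesawDatum L) (w : InfinitePlace L) :
    slotDelta δ S.swap w = if conjSwapAt S w then -slotDelta δ S w else slotDelta δ S w := by
  rw [slotDelta_eq, slotDelta_eq, conjSwapAt_iff, SeesawDatum.swap_r_zero, SeesawDatum.swap_r_one]
  have hs := S.same_sign_iff w
  by_cases h0 : 0 < S.r w 0 <;> by_cases h1 : 0 < S.r w 1
  · obtain ⟨h2, h3⟩ := S.pos_pos w h0 h1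
    simp [h0, h1, h2, h3]
  · have h23 : ¬ (0 < S.r w 2 ↔ 0 < S.r w 3) := fun h => h1 (hs.2 h |>.1 h0)
    by_cases h2 : 0 < S.r w 2
    · have h3 : ¬ 0 < S.r w 3 := fun h3 => h23 ⟨fun _ => h3, fun _ => h2⟩
      simp [h0, h1, h2, h3]
    · have h3 : 0 < S.r w 3 := by
        by_contra h3
        exact h23 ⟨fun h => absurd h h2, fun h => absurd h h3⟩
      simp [h0, h1, h2, h3]
      split_ifs <;> norm_num
  · have h23 : ¬ (0 < S.r w 2 ↔ 0 < S.r w 3) := fun h => h0 (hs.2 h |>.2 h1)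
    by_cases h2 : 0 < S.r w 2
    · have h3 : ¬ 0 < S.r w 3 := fun h3 => h23 ⟨fun _ => h3, fun _ => h2⟩
      simp [h0, h1, h2, h3]
      split_ifs <;> norm_num
    · have h3 : 0 < S.r w 3 := by
        by_contra h3
        exact h23 ⟨fun h => absurd h h2, fun h => absurd h h3⟩
      simp [h0, h1, h2, h3]
  · have h0' : S.r w 0 < 0 := lt_of_le_of_ne (not_lt.1 h0) (S.r_ne_zero w 0)
    have h1' : S.r w 1 < 0 := lt_of_le_of_ne (not_lt.1 h1) (S.r_ne_zero w 1)
    obtain ⟨h2, h3⟩ := S.neg_neg w h0' h1'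
    simp [h0, h1, not_lt.2 h2.le, not_lt.2 h3.le]

/-- `δ_{S.swap} = δ₃ − δ₂` at every place. -/
theorem slotDelta_swap_eq (δ : L) (S : SeesawDatum L) (w : InfinitePlace L) :
    slotDelta δ S.swap w = slotDelta₃ δ S w - slotDelta₂ δ S w := by
  rw [slotDelta_swap]
  unfold slotDelta₂ slotDelta₃
  split_ifs <;> simp

/-- `δ₂ = (δ_S − δ_{S.swap}) / 2` and `δ₃ = (δ_S + δ_{S.swap}) / 2`: the two cross-plane tables are the odd and the even
part of the slot table under the seesaw swap. -/
theorem two_mul_slotDelta₂ (δ : L) (S : SeesawDatum L) (w : InfinitePlace L) :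
    2 * slotDelta₂ δ S w = slotDelta δ S w - slotDelta δ S.swap w ∧
    2 * slotDelta₃ δ S w = slotDelta δ S w + slotDelta δ S.swap w := by
  rw [slotDelta_swap_eq]
  obtain ⟨h, _⟩ := slotDelta₂_add_slotDelta₃_aux δ S w
  constructor <;> linarith

/-! ### `δ₂` is odd and `δ₃` is even under the swap -/

namespace SeesawDatum

/-- Two seesaw data with the same discriminants are equal (the other fields are proofs). -/
theorem ext' {S T : SeesawDatum L} (h : S.a = T.a) : S = T := by
  cases S; cases T; cases h; rfl

/-- The swap is an involution. -/
theorem swap_swap (S : SeesawDatum L) : S.swap.swap = S := by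
  apply ext'
  funext i
  fin_cases i <;> rfl

end SeesawDatum

/-- The relabelling bit is symmetric under the swap (`a₀, a₂` have opposite signs iff `a₂, a₀` do). -/
theorem conjSwapAt_swap (S : SeesawDatum L) (w : InfinitePlace L) : conjSwapAt S.swap w ↔ conjSwapAt S w := by
  rw [conjSwapAt_iff, conjSwapAt_iff, SeesawDatum.swap_r_zero, SeesawDatum.swap_r_two]
  exact not_congr Iff.comm

/-- `δ₂` is ODD under the swap: `δ₂(S.swap) = −δ₂(S)`. -/
theorem slotDelta₂_swap (δ : L) (S : SeesawDatum L) (w : InfinitePlace L) :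
    slotDelta₂ δ S.swap w = -slotDelta₂ δ S w := by
  unfold slotDelta₂
  rw [slotDelta_swap]
  by_cases h : conjSwapAt S w
  · rw [if_pos ((conjSwapAt_swap S w).2 h), if_pos h, if_pos h]
  · rw [if_neg (fun h' => h ((conjSwapAt_swap S w).1 h')), if_neg h, neg_zero]

/-- `δ₃` is EVEN under the swap: `δ₃(S.swap) = δ₃(S)`. -/
theorem slotDelta₃_swap (δ : L) (S : SeesawDatum L) (w : InfinitePlace L) :
    slotDelta₃ δ S.swap w = slotDelta₃ δ S w := by
  unfold slotDelta₃
  rw [slotDelta_swap]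
  by_cases h : conjSwapAt S w
  · rw [if_pos ((conjSwapAt_swap S w).2 h), if_pos h]
  · rw [if_neg (fun h' => h ((conjSwapAt_swap S w).1 h')), if_neg h, if_neg h]

end MuTable

end Summit.Ventures.HodgeRepro

end
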